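import Summits.AtomisticToContinuum.HydrodynamicLimit.Theorems.CollisionIsometryCLTAdaptedWeightCLTTLPastDampingDensityCap
import Literature.MathematicalPhysics.KineticTheory.HardSphereOrbitVariation
import Literature.MathematicalPhysics.KineticTheory.HardSphereEulerProofs
import Literature.Analysis.FluidPDE.HardSphereDynamicsProofs
import Literature.Analysis.FluidPDE.ReleaseLogBoundDatum
import Literature.Analysis.FluidPDE.HardSpherePhaseSpaceProofs
import HarnessLib

/-!
# Tools for the mesoscopic Chebyshev window (line `meso-chebyshev-window` of the crux `AprioriBounds`,
stmt-AtomisticToContinuum-14827): pathwise moduli of the kernel block density and counted nets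

Support file (`--supports stmt-AtomisticToContinuum-14827`) for the registered stub
`stub_partTwo_of_meanVariance`.  Everything here is DETERMINISTIC and elementary:

* `abs_density_sub_le_sum_euclidDist` — for a smooth kernel `φ` with `‖∇φ‖ ≤ L`, the block density
  `ρ̄_w(x) = (N+1)⁻¹ ∑ᵢ φ(qᵢ − x)` of two configurations of the same spheres differs by at most
  `(N+1)⁻¹ √3 L ∑ᵢ d(q'ᵢ, qᵢ)` (torus mean value inequality `Torus.abs_sub_le_of_norm_gradient_le`,
  sup-distance `≤` minimal-image distance `Torus.norm_sub_le_euclidDist_holds`);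
* `abs_density_traj_sub_le` / `abs_density_flow_sub_le` — the TIME MODULUS along a hard-sphere orbit:
  `|ρ̄(s', x) − ρ̄(s, x)| ≤ √3 L √(2E) |s' − s|` when the kinetic energy is `≤ (N+1) E`
  (`IsHardSphereTrajectory.sum_euclidDist_le_of_le` + conservation of energy);
* `abs_density_sub_le_norm_centre` — the SPACE MODULUS on the hard-sphere domain:
  `|ρ̄_w(x) − ρ̄_w(x')| ≤ (N+1)⁻¹ · 2(2R/ε + 1)³ · √3 L ‖x − x'‖` for a kernel supported in the
  minimal-image ball of radius `R` (hard-core packing `PastDamping.card_filter_near_le`);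
* `exists_net_T3` — the lattice `(n⁻¹ℤ³) mod 1`: at most `n³` points, sup-distance mesh `1/n`;
* `exists_net_Icc` — the net `{j t / M}` of `[0, t]`: at most `M + 1` points, mesh `t / M`.
-/

noncomputable section

open MeasureTheory Filter Set Topology
open scoped ENNReal

namespace Summit.AtomisticToContinuum.HydrodynamicLimit.Theorems.MesoChebyshevWindow

open Literature.MathematicalPhysics.KineticTheory Literature.Analysis.FluidPDE
open Summit.AtomisticToContinuum.HydrodynamicLimit.Theorems.ContactSourceDuhamel.TimeLocal (PastDamping.card_filter_near_le
  PastDamping.euclidDist_sub_zero)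

variable {N : ℕ}

/-! ## The kernel increment -/

/-- Mean value inequality for a smooth kernel on `𝕋³` with `‖∇φ‖ ≤ L`: `|φ a − φ b| ≤ √3 L ‖a − b‖`
(sup-norm of `𝕋³`). -/
theorem abs_kernel_sub_le {φ : T3 → ℝ} (hφ : Literature.Analysis.FunctionSpaces.Torus.IsSmooth φ) {L : ℝ}
    (hL : ∀ y, ‖Literature.Analysis.FunctionSpaces.Torus.gradient φ y‖ ≤ L) (a b : T3) :
    |φ a - φ b| ≤ Real.sqrt 3 * L * ‖a - b‖ := by
  have h := Torus.abs_sub_le_of_norm_gradient_le hφ hL a b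
  have h3 : ((Fintype.card (Fin 3) : ℕ) : ℝ) = 3 := by simp
  rw [h3] at h
  exact h

/-- The gradient bound forces `0 ≤ L`. -/
theorem nonneg_of_gradient_le {φ : T3 → ℝ} {L : ℝ}
    (hL : ∀ y, ‖Literature.Analysis.FunctionSpaces.Torus.gradient φ y‖ ≤ L) : 0 ≤ L :=
  (norm_nonneg _).trans (hL 0)

/-! ## Time modulus -/

/-- **Two configurations of the same spheres**: the block densities at a common centre `x` differ by at
most `(N+1)⁻¹ · √3 L · ∑ᵢ d(q'ᵢ, qᵢ)` (minimal-image distances). -/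
theorem abs_density_sub_le_sum_euclidDist (w' w : Config (N + 1) (Fin 3) T3) {φ : T3 → ℝ}
    (hφ : Literature.Analysis.FunctionSpaces.Torus.IsSmooth φ) {L : ℝ}
    (hL : ∀ y, ‖Literature.Analysis.FunctionSpaces.Torus.gradient φ y‖ ≤ L) (x : T3) :
    |empiricalDensityField w' (fun y => φ (y - x)) - empiricalDensityField w (fun y => φ (y - x))| ≤
      ((N + 1 : ℕ) : ℝ)⁻¹ * (Real.sqrt 3 * L * ∑ i, Torus.euclidDist (w' i).1 (w i).1) := by
  have hL0 : 0 ≤ L := nonneg_of_gradient_le hL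
  have hns := Torus.norm_sub_le_euclidDist_holds (d := Fin 3)
  rw [empiricalDensityField_eq_sum, empiricalDensityField_eq_sum, ← mul_sub, ← Finset.sum_sub_distrib,
    abs_mul, abs_of_nonneg (inv_nonneg.2 (Nat.cast_nonneg _)), Finset.mul_sum]
  refine mul_le_mul_of_nonneg_left ((Finset.abs_sum_le_sum_abs _ _).trans
    (Finset.sum_le_sum fun i _ => ?_)) (inv_nonneg.2 (Nat.cast_nonneg _))
  calc |φ ((w' i).1 - x) - φ ((w i).1 - x)| ≤ Real.sqrt 3 * L * ‖((w' i).1 - x) - ((w i).1 - x)‖ :=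
        abs_kernel_sub_le hφ hL _ _
    _ = Real.sqrt 3 * L * ‖(w' i).1 - (w i).1‖ := by rw [sub_sub_sub_cancel_right]
    _ ≤ Real.sqrt 3 * L * Torus.euclidDist (w' i).1 (w i).1 :=
        mul_le_mul_of_nonneg_left (hns _ _) (by positivity)

/-- **Time modulus along a hard-sphere orbit.**  If the (conserved) kinetic energy is at most
`(N+1) E`, then for all `s, s'` the block density at any centre moves by at most
`√3 L √(2E) |s' − s|` (mean displacement bound `IsHardSphereTrajectory.sum_euclidDist_le_of_le`). -/
theorem abs_density_traj_sub_le {ε : ℝ} {γo : ℝ → Config (N + 1) (Fin 3) T3}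
    (hγ : IsHardSphereTrajectory (Torus.geometry (Fin 3)) ε (N + 1) γo) {φ : T3 → ℝ}
    (hφ : Literature.Analysis.FunctionSpaces.Torus.IsSmooth φ) {L : ℝ}
    (hL : ∀ y, ‖Literature.Analysis.FunctionSpaces.Torus.gradient φ y‖ ≤ L) (x : T3) {E : ℝ}
    (hE : configEnergy (γo 0) ≤ ((N + 1 : ℕ) : ℝ) * E) (s s' : ℝ) :
    |empiricalDensityField (γo s') (fun y => φ (y - x)) - empiricalDensityField (γo s) (fun y => φ (y - x))| ≤
      Real.sqrt 3 * L * Real.sqrt (2 * E) * |s' - s| := by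
  have hL0 : 0 ≤ L := nonneg_of_gradient_le hL
  have hn : (0 : ℝ) < ((N + 1 : ℕ) : ℝ) := by positivity
  have key : ∀ s s' : ℝ, s ≤ s' →
      |empiricalDensityField (γo s') (fun y => φ (y - x)) - empiricalDensityField (γo s) (fun y => φ (y - x))| ≤
        Real.sqrt 3 * L * Real.sqrt (2 * E) * (s' - s) := by
    intro s s' hss'
    have hdisp := hγ.sum_euclidDist_le_of_le hss'
    have hEs : configEnergy (γo s) ≤ ((N + 1 : ℕ) : ℝ) * E := by
      rw [IsHardSphereTrajectory.configEnergy_eq_holds hγ s 0]; exact hE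
    have hsqrt : Real.sqrt ((N + 1 : ℕ) : ℝ) * Real.sqrt (2 * configEnergy (γo s)) ≤
        ((N + 1 : ℕ) : ℝ) * Real.sqrt (2 * E) := by
      calc Real.sqrt ((N + 1 : ℕ) : ℝ) * Real.sqrt (2 * configEnergy (γo s))
          ≤ Real.sqrt ((N + 1 : ℕ) : ℝ) * Real.sqrt (((N + 1 : ℕ) : ℝ) * (2 * E)) :=
            mul_le_mul_of_nonneg_left (Real.sqrt_le_sqrt (by nlinarith)) (Real.sqrt_nonneg _)
        _ = Real.sqrt ((N + 1 : ℕ) : ℝ) * Real.sqrt ((N + 1 : ℕ) : ℝ) * Real.sqrt (2 * E) := by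
            rw [Real.sqrt_mul hn.le, mul_assoc]
        _ = ((N + 1 : ℕ) : ℝ) * Real.sqrt (2 * E) := by rw [Real.mul_self_sqrt hn.le]
    calc |empiricalDensityField (γo s') (fun y => φ (y - x)) - empiricalDensityField (γo s) (fun y => φ (y - x))|
        ≤ ((N + 1 : ℕ) : ℝ)⁻¹ * (Real.sqrt 3 * L * ∑ i, Torus.euclidDist (γo s' i).1 (γo s i).1) :=
          abs_density_sub_le_sum_euclidDist _ _ hφ hL x
      _ ≤ ((N + 1 : ℕ) : ℝ)⁻¹ * (Real.sqrt 3 * L *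
            (Real.sqrt ((N + 1 : ℕ) : ℝ) * Real.sqrt (2 * configEnergy (γo s)) * (s' - s))) := by
          gcongr
      _ ≤ ((N + 1 : ℕ) : ℝ)⁻¹ * (Real.sqrt 3 * L * (((N + 1 : ℕ) : ℝ) * Real.sqrt (2 * E) * (s' - s))) := by
          gcongr
      _ = Real.sqrt 3 * L * Real.sqrt (2 * E) * (s' - s) := by
          field_simp
  rcases le_total s s' with h | h
  · rw [abs_of_nonneg (sub_nonneg.2 h)]
    exact key s s' h
  · rw [abs_sub_comm, abs_of_nonpos (sub_nonpos.2 h), neg_sub]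
    exact key s' s h

/-- **Time modulus along a good orbit of a hard-sphere flow** (`abs_density_traj_sub_le` for the orbit
`τ ↦ Φ_τ z`, `Φ₀ z = z`). -/
theorem abs_density_flow_sub_le {ε : ℝ} (Ψ : HardSphereFlow (Torus.geometry (Fin 3)) ε (N + 1))
    {z : Config (N + 1) (Fin 3) T3} (hz : z ∈ Ψ.good) {φ : T3 → ℝ}
    (hφ : Literature.Analysis.FunctionSpaces.Torus.IsSmooth φ) {L : ℝ}
    (hL : ∀ y, ‖Literature.Analysis.FunctionSpaces.Torus.gradient φ y‖ ≤ L) {E : ℝ}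
    (hE : configEnergy z ≤ ((N + 1 : ℕ) : ℝ) * E) (s s' : ℝ) (x : T3) :
    |empiricalDensityField (Ψ.flow s' z) (fun y => φ (y - x)) -
        empiricalDensityField (Ψ.flow s z) (fun y => φ (y - x))| ≤
      Real.sqrt 3 * L * Real.sqrt (2 * E) * |s' - s| := by
  have hγ := Ψ.isTrajectory z hz
  have h0 : configEnergy ((fun τ => Ψ.flow τ z) 0) ≤ ((N + 1 : ℕ) : ℝ) * E := by
    simp only [Ψ.flow_zero z hz]; exact hE
  exact abs_density_traj_sub_le hγ hφ hL x h0 s s'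

/-! ## Space modulus -/

/-- **Space modulus on the hard-sphere domain.**  For a kernel supported in the minimal-image ball of
radius `R` about `0` with `‖∇φ‖ ≤ L`, and a configuration whose centres are mutually `ε`-separated
(`R + ε/2 < 1/2`): `|ρ̄_w(x) − ρ̄_w(x')| ≤ (N+1)⁻¹ · 2(2R/ε + 1)³ · √3 L · ‖x − x'‖` — only the spheres
within `R` of `x` or of `x'` contribute, at most `(2R/ε + 1)³` of each (`PastDamping.card_filter_near_le`). -/
theorem abs_density_sub_le_norm_centre {ε R : ℝ} {w : Config (N + 1) (Fin 3) T3}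
    (hw : w ∈ hardSphereDomain (Torus.geometry (Fin 3)) (N + 1) ε) {φ : T3 → ℝ}
    (hφ : Literature.Analysis.FunctionSpaces.Torus.IsSmooth φ) {L : ℝ}
    (hL : ∀ y, ‖Literature.Analysis.FunctionSpaces.Torus.gradient φ y‖ ≤ L)
    (hsupp : ∀ y, R ≤ Torus.euclidDist y 0 → φ y = 0)
    (hε : 0 < ε) (hR : 0 ≤ R) (hhalf : R + ε / 2 < 1 / 2) (x x' : T3) :
    |empiricalDensityField w (fun y => φ (y - x)) - empiricalDensityField w (fun y => φ (y - x'))| ≤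
      ((N + 1 : ℕ) : ℝ)⁻¹ * (2 * (2 * R / ε + 1) ^ 3 * (Real.sqrt 3 * L)) * ‖x - x'‖ := by
  classical
  have hL0 : 0 ≤ L := nonneg_of_gradient_le hL
  set ℓ : ℝ := Real.sqrt 3 * L * ‖x - x'‖ with hℓ
  have hℓ0 : 0 ≤ ℓ := by positivity
  set A : Finset (Fin (N + 1)) := Finset.univ.filter fun i => Torus.euclidDist (w i).1 x < R with hA
  set A' : Finset (Fin (N + 1)) := Finset.univ.filter fun i => Torus.euclidDist (w i).1 x' < R with hA'
  have hsep : ∀ i ∈ (Finset.univ : Finset (Fin (N + 1))), ∀ j ∈ (Finset.univ : Finset (Fin (N + 1))),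
      i ≠ j → ε ≤ Torus.euclidDist (w i).1 (w j).1 := by
    intro i _ j _ hij
    have h := (mem_hardSphereDomain.1 hw) i j hij
    rwa [Torus.norm_geometry_sepVec] at h
  have hAc : (A.card : ℝ) ≤ (2 * R / ε + 1) ^ 3 :=
    PastDamping.card_filter_near_le Finset.univ (fun i => (w i).1) x hε hR hhalf hsep
  have hA'c : (A'.card : ℝ) ≤ (2 * R / ε + 1) ^ 3 :=
    PastDamping.card_filter_near_le Finset.univ (fun i => (w i).1) x' hε hR hhalf hsep
  have hterm : ∀ i, |φ ((w i).1 - x) - φ ((w i).1 - x')| ≤ ℓ := by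
    intro i
    calc |φ ((w i).1 - x) - φ ((w i).1 - x')| ≤ Real.sqrt 3 * L * ‖((w i).1 - x) - ((w i).1 - x')‖ :=
          abs_kernel_sub_le hφ hL _ _
      _ = ℓ := by rw [sub_sub_sub_cancel_left, norm_sub_rev]
  have hzero : ∀ i, i ∉ A ∪ A' → |φ ((w i).1 - x) - φ ((w i).1 - x')| = 0 := by
    intro i hi
    rw [Finset.mem_union, not_or] at hi
    have h1 : ¬ Torus.euclidDist (w i).1 x < R := fun h =>
      hi.1 (Finset.mem_filter.2 ⟨Finset.mem_univ _, h⟩)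
    have h2 : ¬ Torus.euclidDist (w i).1 x' < R := fun h =>
      hi.2 (Finset.mem_filter.2 ⟨Finset.mem_univ _, h⟩)
    rw [hsupp _ (by rw [PastDamping.euclidDist_sub_zero]; exact le_of_not_gt h1),
      hsupp _ (by rw [PastDamping.euclidDist_sub_zero]; exact le_of_not_gt h2), sub_self, abs_zero]
  rw [empiricalDensityField_eq_sum, empiricalDensityField_eq_sum, ← mul_sub, ← Finset.sum_sub_distrib,
    abs_mul, abs_of_nonneg (inv_nonneg.2 (Nat.cast_nonneg _)), mul_assoc]
  refine mul_le_mul_of_nonneg_left ?_ (inv_nonneg.2 (Nat.cast_nonneg _))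
  calc |∑ i, (φ ((w i).1 - x) - φ ((w i).1 - x'))|
      ≤ ∑ i, |φ ((w i).1 - x) - φ ((w i).1 - x')| := Finset.abs_sum_le_sum_abs _ _
    _ = ∑ i ∈ A ∪ A', |φ ((w i).1 - x) - φ ((w i).1 - x')| :=
        (Finset.sum_subset (Finset.subset_univ _) (fun i _ hi => hzero i hi)).symm
    _ ≤ ∑ _i ∈ A ∪ A', ℓ := Finset.sum_le_sum fun i _ => hterm i
    _ = ((A ∪ A').card : ℝ) * ℓ := by rw [Finset.sum_const, nsmul_eq_mul]
    _ ≤ ((A.card : ℝ) + A'.card) * ℓ := by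
        gcongr
        exact_mod_cast Finset.card_union_le A A'
    _ ≤ (2 * (2 * R / ε + 1) ^ 3) * ℓ := by
        gcongr
        linarith
    _ = 2 * (2 * R / ε + 1) ^ 3 * (Real.sqrt 3 * L) * ‖x - x'‖ := by rw [hℓ]; ring

/-! ## Counted nets -/

/-- Rounding down to the lattice `n⁻¹ℕ`: `0 ≤ r − ⌊r n⌋/n ≤ 1/n`. -/
theorem sub_floor_div_mem {r : ℝ} (hr : 0 ≤ r) {n : ℕ} (hn : 0 < n) :
    0 ≤ r - (⌊r * n⌋₊ : ℝ) / n ∧ r - (⌊r * n⌋₊ : ℝ) / n ≤ 1 / n := by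
  have hn' : (0 : ℝ) < n := by exact_mod_cast hn
  have h1 : (⌊r * n⌋₊ : ℝ) ≤ r * n := Nat.floor_le (by positivity)
  have h2 : r * n < ⌊r * n⌋₊ + 1 := Nat.lt_floor_add_one _
  constructor
  · rw [sub_nonneg, div_le_iff₀ hn']
    exact h1
  · have h3 : r ≤ (1 + (⌊r * n⌋₊ : ℝ)) / n := by rw [le_div_iff₀ hn']; linarith
    rw [add_div] at h3
    linarith

/-- **The lattice net of `𝕋³`.**  For `0 < n` there are at most `n³` points of `𝕋³` (the lattice
`(n⁻¹ℤ³) mod 1`) such that every point of `𝕋³` is within sup-distance `1/n` of one of them. -/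
theorem exists_net_T3 {n : ℕ} (hn : 0 < n) :
    ∃ G : Finset T3, G.card ≤ n ^ 3 ∧ ∀ x : T3, ∃ g ∈ G, ‖x - g‖ ≤ 1 / n := by
  classical
  have hn' : (0 : ℝ) < n := by exact_mod_cast hn
  let lat : (Fin 3 → Fin n) → T3 := fun k j => ((((k j : ℕ) : ℝ) / n : ℝ) : UnitAddCircle)
  refine ⟨Finset.univ.image lat, ?_, fun x => ?_⟩
  · calc (Finset.univ.image lat).card ≤ (Finset.univ : Finset (Fin 3 → Fin n)).card := Finset.card_image_le
      _ = n ^ 3 := by simp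
  · let r : Fin 3 → ℝ := fun j => (AddCircle.equivIco (1 : ℝ) 0 (x j) : ℝ)
    have hr : ∀ j, r j ∈ Ico (0 : ℝ) (0 + 1) := fun j => (AddCircle.equivIco (1 : ℝ) 0 (x j)).2
    have hk : ∀ j, ⌊r j * n⌋₊ < n := by
      intro j
      have h1 : r j < 1 := by have := (hr j).2; linarith
      refine (Nat.floor_lt (by have := (hr j).1; positivity)).2 ?_
      calc r j * n < 1 * n := mul_lt_mul_of_pos_right h1 hn'
        _ = n := one_mul _
    let k : Fin 3 → Fin n := fun j => ⟨⌊r j * n⌋₊, hk j⟩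
    refine ⟨lat k, Finset.mem_image_of_mem _ (Finset.mem_univ _), ?_⟩
    rw [pi_norm_le_iff_of_nonneg (by positivity)]
    intro j
    have hxj : x j = ((r j : ℝ) : UnitAddCircle) := (AddCircle.coe_equivIco).symm
    have hfl := sub_floor_div_mem (hr j).1 hn
    calc ‖(x - lat k) j‖ = ‖((r j : ℝ) : UnitAddCircle) - ((((⌊r j * n⌋₊ : ℕ) : ℝ) / n : ℝ) : UnitAddCircle)‖ := by
          rw [Pi.sub_apply, hxj]
      _ = ‖((r j - ((⌊r j * n⌋₊ : ℕ) : ℝ) / n : ℝ) : UnitAddCircle)‖ := by rw [AddCircle.coe_sub]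
      _ ≤ ‖r j - ((⌊r j * n⌋₊ : ℕ) : ℝ) / n‖ := QuotientAddGroup.norm_mk_le_norm
      _ ≤ 1 / n := by
          rw [Real.norm_eq_abs, abs_of_nonneg hfl.1]
          exact hfl.2

/-- **The net of `[0, t]`.**  For `0 < t`, `0 < M` there are at most `M + 1` points of `[0, t]` (the
points `j t / M`) such that every `s ∈ [0, t]` is within `t / M` of one of them. -/
theorem exists_net_Icc {t : ℝ} (ht : 0 < t) {M : ℕ} (hM : 0 < M) :
    ∃ S : Finset ℝ, S.card ≤ M + 1 ∧ (∀ s ∈ S, s ∈ Icc 0 t) ∧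
      ∀ s ∈ Icc 0 t, ∃ s' ∈ S, |s - s'| ≤ t / M := by
  classical
  have hM' : (0 : ℝ) < M := by exact_mod_cast hM
  refine ⟨(Finset.range (M + 1)).image fun j : ℕ => (j : ℝ) / M * t, ?_, ?_, ?_⟩
  · exact Finset.card_image_le.trans (by simp)
  · intro s hs
    obtain ⟨j, hj, rfl⟩ := Finset.mem_image.1 hs
    have hjM : (j : ℝ) ≤ M := by exact_mod_cast Nat.lt_succ_iff.1 (Finset.mem_range.1 hj)
    refine ⟨by positivity, ?_⟩
    calc (j : ℝ) / M * t ≤ 1 * t := by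
          refine mul_le_mul_of_nonneg_right ?_ ht.le
          rwa [div_le_one hM']
      _ = t := one_mul t
  · intro s hs
    have hr0 : 0 ≤ s / t := div_nonneg hs.1 ht.le
    have hr1 : s / t ≤ 1 := div_le_one_of_le₀ hs.2 ht.le
    have hfl := sub_floor_div_mem hr0 hM
    have hjle : ⌊s / t * M⌋₊ ≤ M := by
      refine Nat.floor_le_of_le ?_
      calc s / t * M ≤ 1 * M := mul_le_mul_of_nonneg_right hr1 hM'.le
        _ = M := one_mul _
    refine ⟨((⌊s / t * M⌋₊ : ℕ) : ℝ) / M * t,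
      Finset.mem_image.2 ⟨⌊s / t * M⌋₊, Finset.mem_range.2 (Nat.lt_succ_of_le hjle), rfl⟩, ?_⟩
    have hs_eq : s = s / t * t := by rw [div_mul_cancel₀ _ ht.ne']
    rw [hs_eq, ← sub_mul, abs_mul, abs_of_pos ht, abs_of_nonneg (by rw [← hs_eq]; exact hfl.1)]
    rw [← hs_eq]
    calc (s / t - ((⌊s / t * M⌋₊ : ℕ) : ℝ) / M) * t ≤ 1 / M * t :=
          mul_le_mul_of_nonneg_right hfl.2 ht.le
      _ = t / M := by ring

/-! ## Registered Tools sub-stub -/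

/-- Registered Tools sub-stub of this helper file (line `meso-chebyshev-window`, stub
`stub_partTwo_of_meanVariance`): the counted nets of `𝕋³` (`exists_net_T3`) and of `[0, t]` (`exists_net_Icc`). -/
theorem stub_mesoPartTwoTools : (∀ n : ℕ, 0 < n → ∃ G : Finset T3, G.card ≤ n ^ 3 ∧ ∀ x : T3, ∃ g ∈ G, ‖x - g‖ ≤ 1 / n) ∧ (∀ t : ℝ, 0 < t → ∀ M : ℕ, 0 < M → ∃ S : Finset ℝ, S.card ≤ M + 1 ∧ (∀ s ∈ S, s ∈ Icc 0 t) ∧ ∀ s ∈ Icc 0 t, ∃ s' ∈ S, |s - s'| ≤ t / M) :=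
  ⟨fun _ hn => exists_net_T3 hn, fun _ ht _ hM => exists_net_Icc ht hM⟩

end Summit.AtomisticToContinuum.HydrodynamicLimit.Theorems.MesoChebyshevWindow

end
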